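import Summits.CriticalPhenomena.CardyFormulaZ2.Theorems.CardyIKTransportIKLinearTransportScreeningGauge

/-!
# `stub_Screening` (crux stmt-CriticalPhenomena-5076, line `pinned-diagram-exchange`) — ASSEMBLY VOCABULARY

Definitions-only support file (`--supports stmt-CriticalPhenomena-5076`, registered sub-goal `pcol_props`) of
the lead's assembly of the registered stub `stub_Screening` (far-field ratio weak mixing of the gauge colour
field) from the landed finite-array estimates `screeningArray` (p119372) / `screeningOffset` (p118204) and the
gauge identities of `…ScreeningGauge.lean` (p117282). Objects the LINE posits for its own bookkeeping (not
literature): the bias vector `pcol`, the internal plaquette array `Qarr`, the box coins `Cbox`, the environment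
projection `projEnv`, and the synthetic observables `farObs` / `boxObs` through which the sheared observables
factor on the far cells / on the box. The assembly sub-goals over this vocabulary (`obsShear_agree_far`,
`obsShear_agree_box`, `farObs_projEnv`, `boxObs_projEnv`, `boxObs_offset`, `measurable_projEnv`,
`measurable_farObs`, `measurable_boxObs`, `integral_env_arr_coins`, `screening_error_small`) are registered on
the crux item and land in sibling files.

SETTING (fixed `S a b w h n`): near region `[x₁, x₂) × [y₁, y₂)`, `x₁ = a - n`, `x₂ = a + w + n`, `y₁ = b - n`,
`y₂ = b + h + n`; internal plaquette array `m × k`, `m = w + 2n - 1`, `k = h + 2n - 1`, entry `(c, r)` = the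
plaquette bit of the face `(x₁ + c, y₁ + r)`; after the anchored shear `screenShear` (μIK-preserving) the far
observables are `farObs (environment, parities of Qarr)` and the box observables are
`boxObs (environment, boxData (Qarr), Cbox)`, the environment entering the box colours through an additive offset.
-/

noncomputable section

namespace Summit.CriticalPhenomena.CardyFormulaZ2.Theorems.IKLinearTransport.PinnedDiagramExchange.ScreeningAssembly

open scoped Classical
open MeasureTheory Set
open Literature.Probability.Percolation Literature.Probability.LatticeModels
open ScreeningGauge

/-! ## §1 Vocabulary -/

/-- The IK mask density `θ = 7 − 4√3 ≈ 0.0718`: the bias bound `|1 − 2p|` of the plaquette bits. [folklore] -/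
def θIK : ℝ := 7 - 4 * Real.sqrt 3

/-- Column biases of the internal plaquette array (array column `c` = face column `x₁ + c`). [folklore] -/
def pcol (S : Set ℤ) (x₁ : ℤ) (m : ℕ) : Fin m → ℝ :=
  fun c => if x₁ + (c : ℤ) ∈ S then
    ((Set.projIcc (0 : ℝ) 1 zero_le_one (2 * Real.sqrt 3 - 3) : unitInterval) : ℝ) else 1 / 2

/-- The internal plaquette array read by the pattern `S`. [folklore] -/
def Qarr (S : Set ℤ) (x₁ y₁ : ℤ) (m k : ℕ) (ω : Ω) : Fin m × Fin k → Bool :=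
  fun f => decide (plaq S ω (x₁ + (f.1 : ℤ), y₁ + (f.2 : ℤ)))

/-- The coins of the box faces (faces labelled by their lower-left cell `(a + i, b + j)`). [folklore] -/
def Cbox (a b : ℤ) (w h : ℕ) (ω : Ω) : Fin w × Fin h → Bool :=
  fun ij => decide ((![a + (ij.1 : ℤ), b + (ij.2 : ℤ)] : Site 2) ∈ ω.2.2.2.2)

/-- Internal faces of the near region, as cells. [folklore] -/
def intCells (x₁ x₂ y₁ y₂ : ℤ) : Set (Site 2) := {f | x₁ ≤ f 0 ∧ f 0 < x₂ - 1 ∧ y₁ ≤ f 1 ∧ f 1 < y₂ - 1}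

/-- The cell box `[a, a+w) × [b, b+h)`. [folklore] -/
def boxCells (a b : ℤ) (w h : ℕ) : Set (Site 2) := {v | a ≤ v 0 ∧ v 0 < a + w ∧ b ≤ v 1 ∧ v 1 < b + h}

/-- The ENVIRONMENT projection: signs kept, plaquettes kept off the internal faces, coins kept off the box. [folklore] -/
def projEnv (a b : ℤ) (w h n : ℕ) (ω : Ω) : Ω :=
  (ω.1, ω.2.1, ω.2.2.1 ∩ (intCells (a - n) (a + w + n) (b - n) (b + h + n))ᶜ,
    ω.2.2.2.1 ∩ (intCells (a - n) (a + w + n) (b - n) (b + h + n))ᶜ, ω.2.2.2.2 ∩ (boxCells a b w h)ᶜ)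

/-- The internal-plaquette parity seen by a FAR cell `v`, read from the parity data `kk`: a parity of full
column parities below the near region, of full row parities to its left, nothing above / to the right. [folklore] -/
def farIn (x₁ x₂ y₁ y₂ : ℤ) (m k : ℕ) (kk : (Fin m → Bool) × (Fin k → Bool)) (v : Site 2) : Prop :=
  (v 1 < y₁ ∧ Odd (((Finset.Ico (min (v 0) x₂) (max (v 0) x₂) ∩ Finset.Ico x₁ (x₂ - 1)).filter
      (fun c => ∃ i : Fin m, x₁ + (i : ℤ) = c ∧ kk.1 i = true)).card)) ∨
  (y₁ ≤ v 1 ∧ v 0 < x₁ ∧ Odd (((Finset.Ico (v 1) (y₂ - 1)).filter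
      (fun r => ∃ j : Fin k, y₁ + (j : ℤ) = r ∧ kk.2 j = true)).card))

/-- FAR SYNTHETIC OBSERVABLES: the sheared observables rebuilt from (environment, parity data). [folklore] -/
def farObs (S : Set ℤ) (x₁ x₂ y₁ y₂ : ℤ) (m k : ℕ) (ω : Ω) (kk : (Fin m → Bool) × (Fin k → Bool)) : Obs :=
  ({v | Xor (v 0 ∈ ω.1) (Xor (v 1 ∈ ω.2.1)
      (Xor (outPar S x₁ x₂ y₁ y₂ ω (rect0 (v 0) (v 1))) (farIn x₁ x₂ y₁ y₂ m k kk v)))},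
   {f | f 0 ∉ S ∨ f ∈ ω.2.2.2.2})

/-- BOX SYNTHETIC OBSERVABLES: the sheared observables of the box rebuilt from (environment, box data, coins). [folklore] -/
def boxObs (S : Set ℤ) (x₁ x₂ y₁ y₂ a b : ℤ) (w h : ℕ) (ω : Ω) (t cc : Fin w × Fin h → Bool) : Obs :=
  ({v | ∃ ij : Fin w × Fin h, v = ![a + (ij.1 : ℤ), b + (ij.2 : ℤ)] ∧
      Xor (v 0 ∈ ω.1) (Xor (v 1 ∈ ω.2.1) (Xor (outPar S x₁ x₂ y₁ y₂ ω (rect0 (v 0) (v 1))) (t ij = true)))},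
   {f | ∃ ij : Fin w × Fin h, f = ![a + (ij.1 : ℤ), b + (ij.2 : ℤ)] ∧ (f 0 ∉ S ∨ cc ij = true)})


/-! ## §2 The biases -/

/-- `3/2 < √3 < 7/4`. [folklore] -/
theorem sqrt3_bounds : (3 : ℝ) / 2 < Real.sqrt 3 ∧ Real.sqrt 3 < 7 / 4 := by
  constructor
  · rw [show (3 : ℝ) / 2 = Real.sqrt ((3 / 2) ^ 2) by rw [Real.sqrt_sq (by norm_num)]]
    exact Real.sqrt_lt_sqrt (by norm_num) (by norm_num)
  · rw [show (7 : ℝ) / 4 = Real.sqrt ((7 / 4) ^ 2) by rw [Real.sqrt_sq (by norm_num)]]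
    exact Real.sqrt_lt_sqrt (by norm_num) (by norm_num)

/-- `0 ≤ θ = 7 − 4√3 ≤ 1` (indeed `< 1/8`). [folklore] -/
theorem θIK_bounds : 0 ≤ θIK ∧ θIK ≤ 1 ∧ θIK < 1 / 8 := by
  obtain ⟨h1, h2⟩ := sqrt3_bounds
  have h3 : Real.sqrt 3 ^ 2 = 3 := Real.sq_sqrt (by norm_num)
  refine ⟨?_, ?_, ?_⟩ <;> rw [θIK] <;> nlinarith

/-- The biased parameter is `2√3 − 3 ∈ [0, 1]`, so `projIcc` does not clip it. [folklore] -/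
theorem coe_projIcc_pIK :
    ((Set.projIcc (0 : ℝ) 1 zero_le_one (2 * Real.sqrt 3 - 3) : unitInterval) : ℝ) = 2 * Real.sqrt 3 - 3 := by
  obtain ⟨h1, h2⟩ := sqrt3_bounds
  rw [Set.projIcc_of_mem _ ⟨by linarith, by linarith⟩]

/-- REGISTERED SUB-GOAL `pcol_props`: the column biases lie in `[0, 1]` and satisfy `|1 − 2p| ≤ θ`, and
`0 ≤ θ ≤ 1`. [folklore] -/
theorem pcol_props :
    ∀ (S : Set ℤ) (x₁ : ℤ) (m : ℕ), (∀ c : Fin m, 0 ≤ pcol S x₁ m c ∧ pcol S x₁ m c ≤ 1) ∧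
      (∀ c : Fin m, |1 - 2 * pcol S x₁ m c| ≤ θIK) ∧ 0 ≤ θIK ∧ θIK ≤ 1 := by
  intro S x₁ m
  obtain ⟨hθ0, hθ1, -⟩ := θIK_bounds
  obtain ⟨h1, h2⟩ := sqrt3_bounds
  refine ⟨fun c => ?_, fun c => ?_, hθ0, hθ1⟩
  · unfold pcol
    split_ifs
    · rw [coe_projIcc_pIK]; constructor <;> linarith
    · norm_num
  · unfold pcol
    split_ifs
    · rw [coe_projIcc_pIK, show (1 : ℝ) - 2 * (2 * Real.sqrt 3 - 3) = θIK by rw [θIK]; ring, abs_of_nonneg hθ0]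
    · norm_num; exact hθ0

end Summit.CriticalPhenomena.CardyFormulaZ2.Theorems.IKLinearTransport.PinnedDiagramExchange.ScreeningAssembly
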